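import Summits.ValiantsHypothesis.ValiantsHypothesis.Theorems.BarrierLeverAnchoredDoorHitsLowerPairsSimplexBoundaryMember
import Summits.ValiantsHypothesis.ValiantsHypothesis.Theorems.BarrierLeverAnchoredDoorHitsLowerPairsMono
import Summits.ValiantsHypothesis.ValiantsHypothesis.Theorems.BarrierLeverAnchoredDoorHitsLowerPairsSwap

/-!
# Support item `AnchoredDoorHitsLowerPairs` (stmt-ValiantsHypothesis-22510), line `anchored-peeling`:
# the anchored door hits the RIGID family (∂Δⁿ, Δⁿ⁻¹ ⊔ Δⁿ⁻¹) at every `n` (part 2 — the theorem)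

Helper file (`--supports stmt-ValiantsHypothesis-22510`; cell valiant-natproofs, rung V4, 𝒟-side door (c); prover seat
val-np-p1 gen 16). Closes NO item.

THE FAMILY. `P_n`: rows = the boundary of the `n`-simplex on the `x`-vertices `x_0 … x_{n-1}` and the apex `x_{2n}`
(all subsets of these `n+1` vertices except the full one), columns = two disjoint solid `(n-1)`-simplices on the
`y`-vertices `y_0 … y_{n-1}` and `y_n … y_{2n-1}` (all subsets of either block); `r = 2^{n+1} - 1`, `h = 2n+1`.
Star counts are `2^{n+1-j} - 1` on the row side and `2^{n-k}` on the column side, so the only coincidence is facet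
against facet (`j = k = n`): `P_n` admits NO star(`s`) step as soon as `n > s` — it lies in the residual class of the
line's open stub `stub_rigidPairs` for every profile `s`, and `P_3` (`h = 6`, `r = 15`) is the cell's «first rigid pair»
(val-np-p4 g15, STATUS 2026-08-27T22:23Z); the cube-versus-ball family (`…CubeBall`, `…CubeBallProfileOne`) was the only
rigid family certified before.

THE THEOREM `symbolicDet_one_simplexBoundary_ne_zero`: the symbolic minor of the profile-ONE door 𝔄₁ on `P_n` is nonzero
for every `n`, every injective enumeration of the rows; `symbolicDet_simplexBoundary_ne_zero`: hence for every profile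
`s ≥ 1` (`symbolicDet_ne_zero_mono`, p582728).

THE PROOF (one explicit member with ONE twist, part 1 `…SimplexBoundaryMember`). At the 0/1 point `sbPoint n` the door is
`F = ∏_a (1 + x_a y_a)(1 + x_a y_{n+a})(1 + x_{2n} y_a (1 + x_a))`. Its layout is `[[1,0,0],[0,I,I],[0,B,0]]`
(rows `∅ / S / apex ∪ S'`, columns `∅ / block 1 / block 2`) with `B[S',T] = |S'|·[T = S'] + [T = S' ∪ {c}, c ∉ S']` —
the matrix of the operator `E + Y·` (degree plus multiplication by `Σ_c y_c`) on the zeon algebra of block 1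
(`coeff_sbWitness_hi`, `coeff_sbWitness_apex_lo`). A vector `α` in the left kernel therefore vanishes on the apex-free
rows, and on the apex rows satisfies `Σ_{c∈T} α_{T∖c} + |T| α_T = 0` for every `T` (with `α_{[n]} := 0`, the removed
facet), whence `α_T = (-1)^{|T|} α_∅` and `α ≡ 0` (`det_sbLayout_ne_zero`); a numeric hit makes the symbolic minor nonzero
(`symbolicDet_ne_zero_of_hit`, p575512). The same one-twist mechanism proves the wider gluing class
«`L₂ ∪ apex∗(L₁∖F)` versus `L₁ ⊔ L₂`» (`L₁∖{F} ⊆ L₂`, `F` a facet of `L₁`): peel the disjoint summand `L₂` of the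
column complex by tail-free diagonal bricks, then the cone rows fall to `E + Y`; only `P_n` in that class is rigid, so only
`P_n` is formalised.

WHAT THIS IS NOT: one family; nothing on `stub_rigidPairs` in general, on item 19717, on crux stmt-ValiantsHypothesis-14610,
or on `VP` versus `VNP`.
-/

set_option linter.dupNamespace false

namespace Summit.ValiantsHypothesis.ValiantsHypothesis.Theorems.BarrierLever.AnchoredPeeling

open Finset MvPolynomial
open Summit.ValiantsHypothesis.ValiantsHypothesis.Theorems.BarrierLever.BrickCalculus
  (pexpo pexpo_def pexpo_apply_natAdd brick brick_eq coeff_pexpo_mul_brick)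

noncomputable section

namespace SimplexBoundary

variable {n : ℕ}

/-! ## 2b. The apex fan rule -/

/-- A partition monomial as a product of variables. -/
theorem monomial_pexpo_eq_prod (Z W : Finset (Fin (2 * n + 1))) :
    (monomial (pexpo Z W) (1 : ℂ) : MvPolynomial (Fin ((2 * n + 1) + (2 * n + 1))) ℂ) =
      (∏ b ∈ Z, X (Fin.castAdd (2 * n + 1) b)) * ∏ c ∈ W, X (Fin.natAdd (2 * n + 1) c) := by
  rw [BrickCalculus.prod_X_eq_monomial, BrickCalculus.prod_X_eq_monomial, monomial_mul, one_mul, pexpo_def]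

/-- The apex factor as brick plus one monomial: `afac a = (1 + x_{2n} y_a) + x_{2n} x_a y_a`. -/
theorem afac_eq_brick_add (a : Fin n) :
    afac a = brick {apex n} {lo n a} + monomial (pexpo ({apex n, lo n a}) {lo n a}) 1 := by
  have hne : apex n ≠ lo n a := (lo_ne_apex a).symm
  rw [afac, brick_eq, monomial_pexpo_eq_prod, monomial_pexpo_eq_prod, Finset.prod_pair hne, Finset.prod_singleton,
    Finset.prod_singleton]
  ring

/-- **Row rule for one apex factor**, any `f`:
`coeff_{x^U y^W} (f · afac a) = coeff f + [apex ∈ U][y_a ∈ W] (coeff_{x^{U∖apex} y^{W∖a}} f + [x_a ∈ U] coeff_{x^{U∖apex∖a} y^{W∖a}} f)`. -/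
theorem coeff_pexpo_mul_afac (f : MvPolynomial (Fin ((2 * n + 1) + (2 * n + 1))) ℂ) (a : Fin n)
    (U W : Finset (Fin (2 * n + 1))) :
    coeff (pexpo U W) (f * afac a) = coeff (pexpo U W) f +
      (if {apex n} ⊆ U ∧ {lo n a} ⊆ W then coeff (pexpo (U \ {apex n}) (W \ {lo n a})) f else 0) +
      (if {apex n, lo n a} ⊆ U ∧ {lo n a} ⊆ W then coeff (pexpo (U \ {apex n, lo n a}) (W \ {lo n a})) f else 0) := by
  classical
  rw [afac_eq_brick_add, mul_add, coeff_add, coeff_pexpo_mul_brick, coeff_mul_monomial', mul_one]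
  congr 1
  by_cases hle : {apex n, lo n a} ⊆ U ∧ {lo n a} ⊆ W
  · rw [if_pos ((BrickCalculus.pexpo_le_iff _ _ _ _).mpr hle), if_pos hle, BrickCalculus.pexpo_sub _ _ _ _ hle.1 hle.2]
  · rw [if_neg (fun h' => hle ((BrickCalculus.pexpo_le_iff _ _ _ _).mp h')), if_neg hle]

/-- **Row rule for the apex fan** `∏_{a∈D} afac a`, any `f`: after one apex monomial is used, `x_{2n}` is gone. -/
theorem coeff_pexpo_mul_prod_afac (f : MvPolynomial (Fin ((2 * n + 1) + (2 * n + 1))) ℂ) (D : Finset (Fin n))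
    (U W : Finset (Fin (2 * n + 1))) :
    coeff (pexpo U W) (f * ∏ a ∈ D, afac a) = coeff (pexpo U W) f +
      if apex n ∈ U then ∑ a ∈ D.filter (fun a => lo n a ∈ W),
        (coeff (pexpo (U \ {apex n}) (W \ {lo n a})) f +
          if lo n a ∈ U then coeff (pexpo (U \ {apex n, lo n a}) (W \ {lo n a})) f else 0) else 0 := by
  classical
  induction D using Finset.induction_on generalizing U W with
  | empty => simp
  | insert a₀ D ha₀ ih =>
    rw [Finset.prod_insert ha₀, ← mul_assoc, mul_right_comm, coeff_pexpo_mul_afac, ih, ih, ih]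
    have hap1 : apex n ∉ U \ {apex n} := fun hmem => (Finset.mem_sdiff.mp hmem).2 (Finset.mem_singleton_self _)
    have hap2 : apex n ∉ U \ {apex n, lo n a₀} := fun hmem =>
      (Finset.mem_sdiff.mp hmem).2 (Finset.mem_insert_self _ _)
    rw [if_neg hap1, if_neg hap2, add_zero, add_zero]
    by_cases hap : apex n ∈ U
    · rw [if_pos hap, if_pos hap, Finset.filter_insert]
      have hsub1 : ({apex n} : Finset (Fin (2 * n + 1))) ⊆ U := Finset.singleton_subset_iff.mpr hap
      by_cases hW : lo n a₀ ∈ W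
      · have hsubW : ({lo n a₀} : Finset (Fin (2 * n + 1))) ⊆ W := Finset.singleton_subset_iff.mpr hW
        rw [if_pos hW, Finset.sum_insert (fun hmem => ha₀ (Finset.mem_filter.mp hmem).1), if_pos ⟨hsub1, hsubW⟩]
        by_cases hU : lo n a₀ ∈ U
        · rw [if_pos hU, if_pos ⟨Finset.insert_subset hap (Finset.singleton_subset_iff.mpr hU), hsubW⟩]; ring
        · rw [if_neg hU, if_neg (fun hc => hU (hc.1 (Finset.mem_insert_of_mem (Finset.mem_singleton_self _))))]; ring
      · rw [if_neg hW, if_neg (fun hc => hW (Finset.singleton_subset_iff.mp hc.2)),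
          if_neg (fun hc => hW (Finset.singleton_subset_iff.mp hc.2)), add_zero, add_zero]
    · rw [if_neg hap, if_neg hap, if_neg (fun hc => hap (Finset.singleton_subset_iff.mp hc.1)),
        if_neg (fun hc => hap (hc.1 (Finset.mem_insert_self _ _))), add_zero, add_zero, add_zero]

/-! ## 3. The two entry formulas of the layout -/

/-- **Block-2 columns**: `coeff_{x^S y^{hi(U)}} F = [S = lo(U)]` — an identity block on the apex-free rows, zero elsewhere. -/
theorem coeff_sbWitness_hi (S : Finset (Fin (2 * n + 1))) (U : Finset (Fin n)) :
    coeff (pexpo S (U.map (hi n))) (sbWitness n) = if S = U.map (lo n) then 1 else 0 := by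
  classical
  have hv : ∀ a ∈ (Finset.univ : Finset (Fin n)), (pexpo S (U.map (hi n))) (Fin.natAdd (2 * n + 1) (lo n a)) = 0 := by
    intro a _; rw [pexpo_apply_natAdd, if_neg (lo_not_mem_map_hi U a)]
  rw [sbWitness, mul_comm (∏ a : Fin n, dfac (lo n) a) (∏ a : Fin n, dfac (hi n) a),
    show (∏ a : Fin n, afac a) = ∏ a : Fin n, (1 + X (Fin.natAdd (2 * n + 1) (lo n a)) *
      (X (Fin.castAdd (2 * n + 1) (apex n)) * (1 + X (Fin.castAdd (2 * n + 1) (lo n a))))) from rfl,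
    coeff_mul_prod_one_add_X_mul _ _ _ _ _ hv,
    show (∏ a : Fin n, dfac (lo n) a) = ∏ a : Fin n, (1 + X (Fin.natAdd (2 * n + 1) (lo n a)) *
      X (Fin.castAdd (2 * n + 1) (lo n a))) from rfl,
    coeff_mul_prod_one_add_X_mul _ _ _ _ _ hv, coeff_prod_dfac]
  simp only [Finset.subset_univ, true_and]

/-- `insert apex` is injective on apex-free sets of base vertices. -/
theorem insert_apex_inj {U V : Finset (Fin n)}
    (hUV : insert (apex n) (U.map (lo n)) = insert (apex n) (V.map (lo n))) : U = V := by
  have h' := congrArg (fun s => s.erase (apex n)) hUV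
  simp only [Finset.erase_insert (apex_not_mem_map_lo U), Finset.erase_insert (apex_not_mem_map_lo V)] at h'
  exact Finset.map_injective (lo n) h'

/-- **Apex rows against block-1 columns**: the matrix of `E + Y·`,
`coeff_{x^{apex ∪ lo U'} y^{lo T'}} F = Σ_{a ∈ T'} ([U' = T' ∖ a] + [a ∈ U' ∧ U' = T'])`. -/
theorem coeff_sbWitness_apex_lo (U' T' : Finset (Fin n)) :
    coeff (pexpo (insert (apex n) (U'.map (lo n))) (T'.map (lo n))) (sbWitness n) =
      ∑ a ∈ T', ((if U' = T'.erase a then (1 : ℂ) else 0) + if a ∈ U' ∧ U' = T' then 1 else 0) := by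
  classical
  set S := insert (apex n) (U'.map (lo n)) with hS
  have hv : ∀ a ∈ (Finset.univ : Finset (Fin n)), (pexpo S (T'.map (lo n))) (Fin.natAdd (2 * n + 1) (hi n a)) = 0 := by
    intro a _; rw [pexpo_apply_natAdd, if_neg (hi_not_mem_map_lo T' a)]
  rw [sbWitness, mul_right_comm,
    show (∏ a : Fin n, dfac (hi n) a) = ∏ a : Fin n, (1 + X (Fin.natAdd (2 * n + 1) (hi n a)) *
      X (Fin.castAdd (2 * n + 1) (lo n a))) from rfl,
    coeff_mul_prod_one_add_X_mul _ _ _ _ _ hv, coeff_pexpo_mul_prod_afac, coeff_prod_dfac]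
  -- the bare term vanishes (the apex is not a variable of block 1)
  have hS_ne : ¬ (T' ⊆ Finset.univ ∧ S = T'.map (lo n)) := fun hc =>
    apex_not_mem_map_lo T' (hc.2 ▸ Finset.mem_insert_self _ _)
  rw [if_neg hS_ne, zero_add, if_pos (Finset.mem_insert_self _ _)]
  -- the fan is indexed by `T'`
  have hfilter : (Finset.univ : Finset (Fin n)).filter (fun a => lo n a ∈ T'.map (lo n)) = T' := by
    ext a; simp
  rw [hfilter]
  refine Finset.sum_congr rfl (fun a ha => ?_)
  have hS1 : S \ {apex n} = U'.map (lo n) := by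
    rw [hS, Finset.insert_sdiff_of_mem _ (Finset.mem_singleton_self _), Finset.sdiff_singleton_eq_erase,
      Finset.erase_eq_of_notMem (apex_not_mem_map_lo U')]
  have hS2 : S \ {apex n, lo n a} = (U'.erase a).map (lo n) := by
    rw [hS, Finset.insert_sdiff_of_mem _ (Finset.mem_insert_self _ _), Finset.sdiff_insert,
      Finset.sdiff_singleton_eq_erase, Finset.map_erase, Finset.erase_right_comm,
      Finset.erase_eq_of_notMem (apex_not_mem_map_lo U')]
  have hT : T'.map (lo n) \ {lo n a} = (T'.erase a).map (lo n) := by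
    rw [Finset.sdiff_singleton_eq_erase, Finset.map_erase]
  have hloS : lo n a ∈ S ↔ a ∈ U' := by
    rw [hS, Finset.mem_insert, Finset.mem_map' (lo n)]
    exact ⟨fun h => h.resolve_left (lo_ne_apex a), Or.inr⟩
  rw [hS1, hS2, hT, coeff_prod_dfac, coeff_prod_dfac]
  simp only [Finset.subset_univ, true_and, Finset.map_inj]
  congr 1
  by_cases haU : a ∈ U'
  · rw [if_pos (hloS.mpr haU)]
    refine if_congr ⟨fun h => ⟨haU, ?_⟩, fun h => by rw [h.2]⟩ rfl rfl
    rw [← Finset.insert_erase haU, h, Finset.insert_erase ha]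
  · rw [if_neg (fun h => haU (hloS.mp h)), if_neg (fun h => haU h.1)]

/-! ## 4. The layout has trivial left kernel -/

/-- **`det ≠ 0` for the layout of the explicit member on `P_n`** (any enumeration of the rows; the columns only need to
cover both blocks). -/
theorem det_sbLayout_ne_zero {r : ℕ} (u w : Fin r → Finset (Fin (2 * n + 1))) (hu : Function.Injective u)
    (hR : ∀ S, S ∈ Set.range u ↔
      ∃ U : Finset (Fin n), S = U.map (lo n) ∨ (U ≠ Finset.univ ∧ S = insert (apex n) (U.map (lo n))))
    (hC : ∀ U : Finset (Fin n), U.map (lo n) ∈ Set.range w ∧ U.map (hi n) ∈ Set.range w) :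
    (Matrix.of fun i j : Fin r => coeff (pexpo (u i) (w j)) (sbWitness n)).det ≠ 0 := by
  classical
  intro hdet
  obtain ⟨α, hα, hαM⟩ := Matrix.exists_vecMul_eq_zero_iff.mpr hdet
  apply hα
  -- evaluation of `α` at a shape
  let ev : Finset (Fin (2 * n + 1)) → ℂ := fun S => ∑ i, α i * (if u i = S then 1 else 0)
  have hev_eq : ∀ i, ev (u i) = α i := by
    intro i
    simp only [ev]
    rw [Finset.sum_eq_single i]
    · rw [if_pos rfl, mul_one]
    · intro i' _ hi'; rw [if_neg (fun h => hi' (hu h)), mul_zero]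
    · intro h; exact absurd (Finset.mem_univ i) h
  have hev_zero : ∀ S, S ∉ Set.range u → ev S = 0 := by
    intro S hS
    simp only [ev]
    exact Finset.sum_eq_zero (fun i _ => by rw [if_neg (fun h => hS ⟨i, h⟩), mul_zero])
  -- the column equations
  have hcol : ∀ j, ∑ i, α i * coeff (pexpo (u i) (w j)) (sbWitness n) = 0 := fun j => by
    have := congrFun hαM j
    simpa [Matrix.vecMul, dotProduct] using this
  -- block-2 columns: `α` vanishes on the apex-free rows
  have hlo0 : ∀ U : Finset (Fin n), ev (U.map (lo n)) = 0 := by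
    intro U
    obtain ⟨j, hj⟩ := (hC U).2
    have h0 := hcol j
    simp only [hj, coeff_sbWitness_hi] at h0
    exact h0
  -- apex evaluations
  let aU : Finset (Fin n) → ℂ := fun V => ev (insert (apex n) (V.map (lo n)))
  have haU_top : aU Finset.univ = 0 := by
    apply hev_zero
    intro hmem
    obtain ⟨U, hU | ⟨hU, hS⟩⟩ := (hR _).mp hmem
    · exact apex_not_mem_map_lo U (hU ▸ Finset.mem_insert_self _ _)
    · exact hU (insert_apex_inj hS).symm
  -- block-1 columns: the `E + Y` equations
  have hE : ∀ T' : Finset (Fin n), ∑ a ∈ T', aU (T'.erase a) + (T'.card : ℂ) * aU T' = 0 := by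
    intro T'
    obtain ⟨j, hj⟩ := (hC T').1
    have hterm : ∀ i, α i * coeff (pexpo (u i) (w j)) (sbWitness n) =
        α i * ∑ a ∈ T', ((if u i = insert (apex n) ((T'.erase a).map (lo n)) then (1 : ℂ) else 0) +
          if u i = insert (apex n) (T'.map (lo n)) then 1 else 0) := by
      intro i
      obtain ⟨V, hV | ⟨-, hV⟩⟩ := (hR (u i)).mp ⟨i, rfl⟩
      · have h0 : α i = 0 := by rw [← hev_eq i, hV]; exact hlo0 V
        rw [h0, zero_mul, zero_mul]
      · rw [hj, hV, coeff_sbWitness_apex_lo]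
        congr 1
        refine Finset.sum_congr rfl (fun a ha => ?_)
        congr 1
        · exact if_congr ⟨fun h => by rw [h], fun h => insert_apex_inj h⟩ rfl rfl
        · refine if_congr ⟨fun h => by rw [h.2], fun h => ?_⟩ rfl rfl
          have hVT := insert_apex_inj h
          exact ⟨hVT ▸ ha, hVT⟩
    have h0 := hcol j
    rw [Finset.sum_congr rfl (fun i _ => hterm i)] at h0
    simp only [Finset.mul_sum, mul_add] at h0
    rw [Finset.sum_comm, Finset.sum_congr rfl (fun a _ => Finset.sum_add_distrib), Finset.sum_add_distrib,
      Finset.sum_const, nsmul_eq_mul] at h0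
    exact h0
  -- induction: `aU V = (-1)^|V| · aU ∅`
  have hInd : ∀ k, ∀ V : Finset (Fin n), V.card = k → aU V = (-1) ^ k * aU ∅ := by
    intro k
    induction k with
    | zero => intro V hV; rw [Finset.card_eq_zero.mp hV, pow_zero, one_mul]
    | succ k ih =>
      intro V hV
      have h := hE V
      have hsum : ∑ a ∈ V, aU (V.erase a) = (V.card : ℂ) * ((-1) ^ k * aU ∅) := by
        rw [Finset.sum_congr rfl (fun a ha => ih (V.erase a) (by rw [Finset.card_erase_of_mem ha, hV]; rfl)),
          Finset.sum_const, nsmul_eq_mul]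
      rw [hsum, hV] at h
      have hk : ((k + 1 : ℕ) : ℂ) ≠ 0 := Nat.cast_ne_zero.mpr (Nat.succ_ne_zero k)
      have h' : ((k + 1 : ℕ) : ℂ) * (aU V + (-1) ^ k * aU ∅) = 0 := by rw [← h]; ring
      have h'' := (mul_eq_zero.mp h').resolve_left hk
      rw [pow_succ]
      linear_combination h''
  have h0 : aU ∅ = 0 := by
    have h1 := hInd n Finset.univ (by rw [Finset.card_univ, Fintype.card_fin])
    rw [haU_top] at h1
    exact (mul_eq_zero.mp h1.symm).resolve_left (pow_ne_zero _ (by norm_num))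
  have haU0 : ∀ V, aU V = 0 := fun V => by rw [hInd V.card V rfl, h0, mul_zero]
  -- conclusion
  funext i
  obtain ⟨V, hV | ⟨-, hV⟩⟩ := (hR (u i)).mp ⟨i, rfl⟩
  · rw [Pi.zero_apply, ← hev_eq i, hV]; exact hlo0 V
  · rw [Pi.zero_apply, ← hev_eq i, hV]; exact haU0 V

/-! ## 5. The theorems -/

/-- **𝔄₁ has nonzero symbolic minor on `P_n = (∂Δⁿ, Δⁿ⁻¹ ⊔ Δⁿ⁻¹)` for every `n`** (rows: all subsets of
`{x_0,…,x_{n-1}, x_{2n}}` except the full one; columns: all subsets of `{y_0,…,y_{n-1}}` and of `{y_n,…,y_{2n-1}}`;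
any injective enumeration of the rows). -/
theorem symbolicDet_one_simplexBoundary_ne_zero (n : ℕ) {r : ℕ} (u w : Fin r → Finset (Fin (2 * n + 1)))
    (hu : Function.Injective u)
    (hR : Set.range u = {S | ∃ U : Finset (Fin n), S = U.map (lo n) ∨ (U ≠ Finset.univ ∧ S = insert (apex n) (U.map (lo n)))})
    (hC : Set.range w = {T | ∃ U : Finset (Fin n), T = U.map (lo n) ∨ T = U.map (hi n)}) :
    symbolicDet 1 (2 * n + 1) r u w ≠ 0 := by
  refine symbolicDet_ne_zero_of_hit 1 (2 * n + 1) r u w (sbPoint n) ?_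
  rw [anchoredWitness_sbPoint]
  refine det_sbLayout_ne_zero u w hu (fun S => by rw [hR]; rfl) (fun U => ⟨?_, ?_⟩)
  · rw [hC]; exact ⟨U, Or.inl rfl⟩
  · rw [hC]; exact ⟨U, Or.inr rfl⟩

/-- **Hence every anchored door 𝔄_s, `s ≥ 1`, has nonzero symbolic minor on `P_n`** (profile monotonicity, p582728) —
an infinite family inside the residual class of `stub_rigidPairs` for every `s` (no star(`s`) step once `n > s`). -/
theorem symbolicDet_simplexBoundary_ne_zero (n : ℕ) {s : ℕ} (hs : 1 ≤ s) {r : ℕ} (u w : Fin r → Finset (Fin (2 * n + 1)))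
    (hu : Function.Injective u)
    (hR : Set.range u = {S | ∃ U : Finset (Fin n), S = U.map (lo n) ∨ (U ≠ Finset.univ ∧ S = insert (apex n) (U.map (lo n)))})
    (hC : Set.range w = {T | ∃ U : Finset (Fin n), T = U.map (lo n) ∨ T = U.map (hi n)}) :
    symbolicDet s (2 * n + 1) r u w ≠ 0 :=
  symbolicDet_ne_zero_mono hs (symbolicDet_one_simplexBoundary_ne_zero n u w hu hR hC)


/-- **The transposed family** (rows the two blocks, columns the simplex boundary) is hit as well, by the row/column
symmetry of symbolic non-vanishing (`symbolicDet_ne_zero_comm`, val-np-p4 g16). -/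
theorem symbolicDet_simplexBoundary_transpose_ne_zero (n : ℕ) {s : ℕ} (hs : 1 ≤ s) {r : ℕ}
    (u w : Fin r → Finset (Fin (2 * n + 1))) (hw : Function.Injective w)
    (hR : Set.range u = {T | ∃ U : Finset (Fin n), T = U.map (lo n) ∨ T = U.map (hi n)})
    (hC : Set.range w = {S | ∃ U : Finset (Fin n), S = U.map (lo n) ∨ (U ≠ Finset.univ ∧ S = insert (apex n) (U.map (lo n)))}) :
    symbolicDet s (2 * n + 1) r u w ≠ 0 :=
  symbolicDet_ne_zero_swap s (2 * n + 1) r u w (symbolicDet_simplexBoundary_ne_zero n hs w u hw hC hR)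

end SimplexBoundary

end

end Summit.ValiantsHypothesis.ValiantsHypothesis.Theorems.BarrierLever.AnchoredPeeling
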